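import Literature.NumberTheory.LFunctions.RodgersTaoZeroSet
import Literature.NumberTheory.LFunctions.DeBruijnHHeatFlow
import Literature.NumberTheory.LFunctions.RodgersTaoEnergyV5
import Mathlib.Analysis.Complex.RealDeriv
import Mathlib.Analysis.Calculus.LocalExtr.Rolle
import HarnessLib

/-!
# Rodgers–Tao 2020, Thm. 4.1 (continuity half): the zeros `x_j(t)` of `H_t` move continuously

Trunk T-ANT (`Literature/NumberTheory/LFunctions`). Proofs only (no definitions, no named facts).
Companion of `RodgersTaoZeroSet.lean` (for `t > Λ`: `0 < x_1(t) < x_2(t) < ⋯` are exactly the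
positive zeros of `H_t`, all simple) and of `RodgersTaoEnergyV5Proofs.lean` (§8 of arXiv v5 of
the source, proved there relative to the ordering and the continuity in `t` of the zeros).
B. Rodgers, T. Tao, *The de Bruijn–Newman constant is non-negative*, Forum Math. Pi 8 (2020),
Thm. 4.1 (after Csordas–Smith–Varga 1994) states that for `Λ < t ≤ 0` "the zeroes `x_j(t)` depend
in a continuously differentiable fashion on `t` for each `j`, with the equations of motion
`∂ₜ x_k = 2 ∑' 1/(x_k − x_j)`". This file proves the **continuity** of
`t ↦ x_j(t) = Literature.NumberTheory.LFunctions.deBruijnZero t j` at every `t > Λ` (in the tree's `sInf`-free form: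
`H_{t₁}` has only real zeros for some `t₁ < t`) by elementary real analysis from the joint
continuity of `(t, z) ↦ H_t(z)` (`continuous_deBruijnH_uncurry`) and of `(t, z) ↦ H_t'(z)`
(`continuous_deriv_deBruijnH_uncurry`, `DeBruijnHHeatFlow.lean`):

* `H_t`, `H_t'` are real on `ℝ` (`Literature.NumberTheory.LFunctions.deBruijnH_ofReal_im`,
  `Literature.NumberTheory.LFunctions.deriv_deBruijnH_ofReal_im`);
* `Literature.NumberTheory.LFunctions.exists_box_deriv_sign` — around a simple real zero the real derivative keeps its
  sign on a box in `(t, x)`; hence at most one zero per box slice (Rolle,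
  `Literature.NumberTheory.LFunctions.zero_unique_of_deriv_ne_zero`) and a sign change of `Re H_t` across the box
  (`Literature.NumberTheory.LFunctions.re_mul_re_neg_of_zero`), which persists for nearby times and produces a zero
  (IVT); away from the boxes `H_s ≠ 0` for `s` near `t` (tube lemma,
  `Literature.NumberTheory.LFunctions.eventually_forall_ne_zero_of_isCompact`);
* `Literature.NumberTheory.LFunctions.continuousAt_deBruijnZero` — **`t ↦ x_j(t)` is continuous at every `t > Λ`**
  (an induction on the index pins `x_i(s)` to the `i`-th box);
* `Literature.NumberTheory.LFunctions.continuousAt_renormEnergyOn`, `Literature.NumberTheory.LFunctions.intervalIntegrable_renormEnergyOn_mono`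
  — consequently the renormalised energies `Ẽ^I(t)` of §7 are continuous in `t` on `(Λ, ∞)`, and
  under `Λ < 0` (witness `t₀`) the energy of any sub-window of an integrable window is
  interval-integrable on `[t₀/4, 0]`;
* `Literature.NumberTheory.LFunctions.rodgers_tao_zeros_ordered`, `Literature.NumberTheory.LFunctions.rodgers_tao_zeros_continuousOn` — the
  two regularity hypotheses of `RodgersTaoEnergyV5Proofs.lean` (ordering of `j ↦ x_{j+1}(t)` for
  `t ∈ (t₀, 0]`, continuity of `t ↦ x_{j+1}(t)` on `(t₀, 0]`) are thereby theorems; the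
  assemblies of §8 (arXiv v5) and §9 with these inputs discharged are in the follow-up file
  `RodgersTaoGapsNearMeanV5.lean`.

The differentiability half of Thm. 4.1 and the equations of motion are not treated here.

## References

* B. Rodgers, T. Tao, *The de Bruijn–Newman constant is non-negative*, Forum Math. Pi 8 (2020),
  e6 = arXiv:1801.05914 (v5, 2021, for §8), §1.2, Thm. 4.1, §7.
* G. Csordas, W. Smith, R. S. Varga, *Lehmer pairs of zeros, the de Bruijn–Newman constant `Λ`,
  and the Riemann Hypothesis*, Constr. Approx. 10 (1994), 107–129.
-/

noncomputable section

open Complex Filter Set Topology MeasureTheory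

namespace Literature.NumberTheory.LFunctions

/-! ## `H_t` and `H_t'` on the real axis; joint continuity of the derivative -/

/-- `H_t(x)` is real for real `x` (`H_t(z̄) = conj H_t(z)`). [folklore] -/
theorem deBruijnH_ofReal_im (t x : ℝ) : (deBruijnH t x).im = 0 := by
  have h := deBruijnH_conj t x
  rw [Complex.conj_ofReal] at h
  exact Complex.conj_eq_iff_im.1 h.symm

/-- For real `x`, `H_t(x) = 0 ↔ Re H_t(x) = 0`. [folklore] -/
theorem deBruijnH_ofReal_eq_zero_iff (t x : ℝ) : deBruijnH t x = 0 ↔ (deBruijnH t x).re = 0 := by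
  constructor
  · intro h; rw [h]; rfl
  · intro h; exact Complex.ext h (deBruijnH_ofReal_im t x)

/-- `H_t'(z) = ∫₀^∞ e^{tu²} Φ(u) (−u sin(zu)) du`. [cite: Bruijn1950] -/
theorem deriv_deBruijnH_eq_integral (t : ℝ) (z : ℂ) :
    deriv (deBruijnH t) z = ∫ u in Ioi (0 : ℝ), deBruijnHIntegrand' t z u :=
  (hasDerivAt_deBruijnH t z).deriv

/-- `H_t'(x)` is real for real `x`. [folklore] -/
theorem deriv_deBruijnH_ofReal_im (t x : ℝ) : (deriv (deBruijnH t) x).im = 0 := by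
  rw [deriv_deBruijnH_eq_integral]
  have : (∫ u in Ioi (0 : ℝ), deBruijnHIntegrand' t x u) =
      ((∫ u in Ioi (0 : ℝ), Real.exp (t * u ^ 2) * deBruijnPhi u * (-Real.sin (x * u) * u) : ℝ) : ℂ) := by
    rw [← integral_complex_ofReal]
    refine setIntegral_congr_fun measurableSet_Ioi fun u _ ↦ ?_
    simp only [deBruijnHIntegrand']
    push_cast
    ring
  rw [this, Complex.ofReal_im]

/-- The real function `(s, x) ↦ Re H_s(x)` is jointly continuous. [folklore] -/
theorem continuous_re_deBruijnH_uncurry :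
    Continuous fun p : ℝ × ℝ ↦ (deBruijnH p.1 p.2).re :=
  Complex.continuous_re.comp (continuous_deBruijnH_uncurry.comp
    (continuous_fst.prodMk (Complex.continuous_ofReal.comp continuous_snd)))

/-- The real function `(s, x) ↦ Re H_s'(x)` is jointly continuous. [folklore] -/
theorem continuous_re_deriv_deBruijnH_uncurry :
    Continuous fun p : ℝ × ℝ ↦ (deriv (deBruijnH p.1) p.2).re :=
  Complex.continuous_re.comp (continuous_deriv_deBruijnH_uncurry.comp
    (continuous_fst.prodMk (Complex.continuous_ofReal.comp continuous_snd)))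

/-- `x ↦ Re H_s(x)` has derivative `Re H_s'(x)` along the reals. [folklore] -/
theorem hasDerivAt_re_deBruijnH (s x : ℝ) :
    HasDerivAt (fun x : ℝ ↦ (deBruijnH s x).re) (deriv (deBruijnH s) x).re x :=
  ((differentiable_deBruijnH_holds s) x).hasDerivAt.real_of_complex

/-- `x ↦ Re H_s(x)` is continuous. [folklore] -/
theorem continuous_re_deBruijnH (s : ℝ) : Continuous fun x : ℝ ↦ (deBruijnH s x).re :=
  continuous_re_deBruijnH_uncurry.comp (Continuous.prodMk_right s)

/-! ## Local structure of the real zeros: boxes, uniqueness, sign changes, tubes -/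

/-- **Box lemma.** If `H_t'(x₀) ≠ 0` (`x₀` real), then on a box around `(t, x₀)` the real
derivative `Re H_s'(x)` keeps the sign of `Re H_t'(x₀)` (joint continuity of the derivative).
[folklore] -/
theorem exists_box_deriv_sign {t x₀ : ℝ} (h : deriv (deBruijnH t) x₀ ≠ 0) :
    ∃ δ : ℝ, 0 < δ ∧ ∀ s ∈ Ioo (t - δ) (t + δ), ∀ x ∈ Icc (x₀ - δ) (x₀ + δ),
      0 < (deriv (deBruijnH t) x₀).re * (deriv (deBruijnH s) x).re := by
  set d : ℝ := (deriv (deBruijnH t) x₀).re with hd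
  have hd0 : d ≠ 0 := by
    intro h0
    exact h (Complex.ext h0 (deriv_deBruijnH_ofReal_im t x₀))
  have hcont := (continuous_re_deriv_deBruijnH_uncurry.continuousAt (x := (t, x₀)))
  rw [Metric.continuousAt_iff] at hcont
  obtain ⟨η, hη, hηd⟩ := hcont (|d| / 2) (by positivity)
  refine ⟨η / 2, by positivity, fun s hs x hx ↦ ?_⟩
  have hdist : dist (s, x) (t, x₀) < η := by
    rw [Prod.dist_eq, Real.dist_eq, Real.dist_eq]
    refine max_lt ?_ ?_
    · rw [abs_lt]; constructor <;> linarith [hs.1, hs.2]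
    · rw [abs_lt]; constructor <;> linarith [hx.1, hx.2]
  have hclose : |(deriv (deBruijnH s) x).re - d| < |d| / 2 := by
    have := hηd hdist
    rwa [Real.dist_eq] at this
  -- `d * D = d² + d (D - d) ≥ d² - |d| |D - d| > 0`
  have h1 : d * ((deriv (deBruijnH s) x).re - d) ≥ -(|d| * |(deriv (deBruijnH s) x).re - d|) := by
    rw [← abs_mul]; exact neg_abs_le _
  have h2 : |d| * |(deriv (deBruijnH s) x).re - d| < |d| * (|d| / 2) :=
    mul_lt_mul_of_pos_left hclose (abs_pos.2 hd0)
  have h3 : |d| * |d| = d * d := abs_mul_abs_self d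
  nlinarith [h1, h2, h3, sq_nonneg d, abs_nonneg d]

/-- **At most one zero in a box slice.** If `Re H_s'` does not vanish on `[a, b]`, then `H_s` has
at most one real zero in `[a, b]` (Rolle). [folklore] -/
theorem zero_unique_of_deriv_ne_zero {s a b : ℝ}
    (hD : ∀ x ∈ Icc a b, (deriv (deBruijnH s) x).re ≠ 0) {x y : ℝ} (hx : x ∈ Icc a b)
    (hy : y ∈ Icc a b) (hx0 : deBruijnH s x = 0) (hy0 : deBruijnH s y = 0) : x = y := by
  by_contra hne
  wlog hlt : x < y generalizing x y
  · exact this hy hx hy0 hx0 (Ne.symm hne) (lt_of_le_of_ne (not_lt.1 hlt) (Ne.symm hne))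
  have hfx : (deBruijnH s x).re = (deBruijnH s y).re := by rw [hx0, hy0]
  obtain ⟨c, hc, hc0⟩ := exists_hasDerivAt_eq_zero hlt (continuous_re_deBruijnH s).continuousOn hfx
    (fun z _ ↦ hasDerivAt_re_deBruijnH s z)
  exact hD c ⟨hx.1.trans hc.1.le, hc.2.le.trans hy.2⟩ hc0

/-- **Sign change at a simple zero.** If `Re H_s'` has constant sign on `[a, b]` and `H_s` vanishes
at some `c ∈ (a, b)`, then `Re H_s(a) · Re H_s(b) < 0`. [folklore] -/
theorem re_mul_re_neg_of_zero {s a b c d : ℝ} (hc : c ∈ Ioo a b) (hc0 : deBruijnH s c = 0)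
    (hD : ∀ x ∈ Icc a b, 0 < d * (deriv (deBruijnH s) x).re) :
    (deBruijnH s a).re * (deBruijnH s b).re < 0 := by
  set f : ℝ → ℝ := fun x ↦ (deBruijnH s x).re with hf
  have hfc0 : f c = 0 := by simp only [hf, hc0, Complex.zero_re]
  have hab : a < b := hc.1.trans hc.2
  have hderiv : ∀ x, deriv f x = (deriv (deBruijnH s) x).re := fun x ↦ (hasDerivAt_re_deBruijnH s x).deriv
  have hcont : ContinuousOn f (Icc a b) := (continuous_re_deBruijnH s).continuousOn
  have hd : d ≠ 0 := by
    intro h0; have := hD a ⟨le_rfl, hab.le⟩; rw [h0, zero_mul] at this; exact lt_irrefl _ this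
  rcases lt_or_gt_of_ne hd with hneg | hpos
  · -- `d < 0`: derivative negative, `f` strictly decreasing
    have hanti : StrictAntiOn f (Icc a b) := strictAntiOn_of_deriv_neg (convex_Icc a b) hcont
      fun x hx ↦ by
        rw [interior_Icc] at hx
        rw [hderiv]
        have := hD x (Ioo_subset_Icc_self hx)
        nlinarith
    have h1 : f c < f a := hanti ⟨le_rfl, hab.le⟩ (Ioo_subset_Icc_self hc) hc.1
    have h2 : f b < f c := hanti (Ioo_subset_Icc_self hc) ⟨hab.le, le_rfl⟩ hc.2
    rw [hfc0] at h1 h2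
    exact mul_neg_of_pos_of_neg h1 h2
  · have hmono : StrictMonoOn f (Icc a b) := strictMonoOn_of_deriv_pos (convex_Icc a b) hcont
      fun x hx ↦ by
        rw [interior_Icc] at hx
        rw [hderiv]
        have := hD x (Ioo_subset_Icc_self hx)
        exact pos_of_mul_pos_right this hpos.le
    have h1 : f a < f c := hmono ⟨le_rfl, hab.le⟩ (Ioo_subset_Icc_self hc) hc.1
    have h2 : f c < f b := hmono (Ioo_subset_Icc_self hc) ⟨hab.le, le_rfl⟩ hc.2
    rw [hfc0] at h1 h2
    exact mul_neg_of_neg_of_pos h1 h2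

/-- **Intermediate value.** A sign change of `Re H_s` on `[a, b]` gives a real zero of `H_s` in
`(a, b)`. [folklore] -/
theorem exists_zero_of_re_mul_re_neg {s a b : ℝ} (hab : a ≤ b)
    (h : (deBruijnH s a).re * (deBruijnH s b).re < 0) : ∃ z ∈ Ioo a b, deBruijnH s z = 0 := by
  have hcont : ContinuousOn (fun x : ℝ ↦ (deBruijnH s x).re) (Icc a b) :=
    (continuous_re_deBruijnH s).continuousOn
  rcases mul_neg_iff.1 h with ⟨ha, hb⟩ | ⟨ha, hb⟩
  · obtain ⟨z, hz, hz0⟩ := intermediate_value_Ioo' hab hcont ⟨hb, ha⟩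
    exact ⟨z, hz, (deBruijnH_ofReal_eq_zero_iff s z).2 hz0⟩
  · obtain ⟨z, hz, hz0⟩ := intermediate_value_Ioo hab hcont ⟨ha, hb⟩
    exact ⟨z, hz, (deBruijnH_ofReal_eq_zero_iff s z).2 hz0⟩

/-- **Persistence of a sign change** under perturbation of the time. [folklore] -/
theorem eventually_re_mul_re_neg {t a b : ℝ} (h : (deBruijnH t a).re * (deBruijnH t b).re < 0) :
    ∀ᶠ s in 𝓝 t, (deBruijnH s a).re * (deBruijnH s b).re < 0 := by
  have hc : Continuous fun s : ℝ ↦ (deBruijnH s a).re * (deBruijnH s b).re :=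
    (continuous_re_deBruijnH_uncurry.comp (continuous_id.prodMk continuous_const)).mul
      (continuous_re_deBruijnH_uncurry.comp (continuous_id.prodMk continuous_const))
  exact hc.continuousAt.eventually_lt continuousAt_const h

/-- **Tube lemma.** If `H_t` has no zero on a compact set `K ⊆ ℝ`, neither has `H_s` for `s`
near `t`. [folklore] -/
theorem eventually_forall_ne_zero_of_isCompact {t : ℝ} {K : Set ℝ} (hK : IsCompact K)
    (h : ∀ x ∈ K, deBruijnH t x ≠ 0) : ∀ᶠ s in 𝓝 t, ∀ x ∈ K, deBruijnH s x ≠ 0 := by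
  refine hK.eventually_forall_of_forall_eventually fun x hx ↦ ?_
  have hc : Continuous fun p : ℝ × ℝ ↦ deBruijnH p.1 p.2 :=
    continuous_deBruijnH_uncurry.comp
      (continuous_fst.prodMk (Complex.continuous_ofReal.comp continuous_snd))
  exact hc.continuousAt.eventually_ne (h x hx)

/-- Persistence of the box: for `s` near `t` and `δ' ≤ δ` the box conclusion holds on
`[x₀ − δ', x₀ + δ']`. [folklore] -/
theorem eventually_box {t x₀ δ : ℝ} (hδ : 0 < δ)
    (hbox : ∀ s ∈ Ioo (t - δ) (t + δ), ∀ x ∈ Icc (x₀ - δ) (x₀ + δ),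
      0 < (deriv (deBruijnH t) x₀).re * (deriv (deBruijnH s) x).re) {δ' : ℝ} (hδ' : δ' ≤ δ) :
    ∀ᶠ s in 𝓝 t, ∀ x ∈ Icc (x₀ - δ') (x₀ + δ'),
      0 < (deriv (deBruijnH t) x₀).re * (deriv (deBruijnH s) x).re := by
  filter_upwards [Ioo_mem_nhds (show t - δ < t by linarith) (show t < t + δ by linarith)] with s hs
  exact fun x hx ↦ hbox s hs x ⟨by linarith [hx.1], by linarith [hx.2]⟩

/-! ## Continuity of the zeros in `t` -/

/-- **The zeros `x_j(t)` depend continuously on `t` for `t > Λ`** (the continuity half of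
Rodgers–Tao 2020, Thm. 4.1, after Csordas–Smith–Varga: "the zeroes `x_j(t)` depend in a
continuously differentiable fashion on `t`"). Proof: around each of the simple zeros
`x_1(t) < ⋯ < x_j(t)` the real derivative keeps its sign on a small box (so `H_s` has at most one
zero there and `Re H_s` changes sign, giving exactly one), and away from these boxes `H_s ≠ 0` on
`[0, (x_j(t) + x_{j+1}(t))/2]` for `s` near `t` (tube lemma); an induction on the index then pins
`x_i(s)` to the `i`-th box. [cite: RodgersTaoFMP2020, Thm. 4.1] -/
theorem continuousAt_deBruijnZero {t : ℝ} (hΛ : ∃ t₁ : ℝ, t₁ < t ∧ HasOnlyRealZeros (deBruijnH t₁))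
    (j : ℕ) : ContinuousAt (fun s ↦ deBruijnZero s j) t := by
  rcases Nat.eq_zero_or_pos j with rfl | hj
  · simp only [deBruijnZero_zero]; exact continuousAt_const
  obtain ⟨t₁, ht₁, hreal⟩ := hΛ
  have hΛ : ∃ t₁ : ℝ, t₁ < t ∧ HasOnlyRealZeros (deBruijnH t₁) := ⟨t₁, ht₁, hreal⟩
  -- notation: `q i = x_i(t)`
  set q : ℕ → ℝ := fun i ↦ deBruijnZero t i with hq
  have hqmono : StrictMono q := strictMono_deBruijnZero hΛ
  have hq0 : q 0 = 0 := deBruijnZero_zero t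
  -- boxes around `q 1, …, q j`
  have hboxes : ∀ l : ℕ, ∃ δ : ℝ, 0 < δ ∧ (1 ≤ l → ∀ s ∈ Ioo (t - δ) (t + δ),
      ∀ x ∈ Icc (q l - δ) (q l + δ), 0 < (deriv (deBruijnH t) (q l)).re * (deriv (deBruijnH s) x).re) := by
    intro l
    rcases Nat.eq_zero_or_pos l with rfl | hl
    · exact ⟨1, one_pos, fun h ↦ absurd h (by norm_num)⟩
    · obtain ⟨δ, hδ, hbox⟩ := exists_box_deriv_sign (deriv_deBruijnH_deBruijnZero_ne_zero hΛ hl)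
      exact ⟨δ, hδ, fun _ ↦ hbox⟩
  choose δb hδb hbox using hboxes
  -- the scale `δ₀`: a quarter of the smallest gap among `q 0 < q 1 < ⋯ < q (j+1)`, and the boxes
  set G : Finset ℕ := Finset.range (j + 1) with hG
  have hGne : G.Nonempty := ⟨0, by simp [hG]⟩
  set δ₀ : ℝ := min (G.inf' hGne fun i ↦ (q (i + 1) - q i) / 4) (G.inf' hGne δb) with hδ₀
  have hmemG : ∀ i ≤ j, i ∈ G := fun i hi ↦ by rw [hG, Finset.mem_range]; omega
  have hδ₀gap : ∀ i ≤ j, δ₀ ≤ (q (i + 1) - q i) / 4 := fun i hi ↦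
    (min_le_left _ _).trans (Finset.inf'_le (fun i ↦ (q (i + 1) - q i) / 4) (hmemG i hi))
  have hδ₀box : ∀ i ≤ j, δ₀ ≤ δb i := fun i hi ↦
    (min_le_right _ _).trans (Finset.inf'_le δb (hmemG i hi))
  have hδ₀pos : 0 < δ₀ := by
    refine lt_min ?_ ?_
    · obtain ⟨i, -, hi⟩ := Finset.exists_mem_eq_inf' hGne fun i ↦ (q (i + 1) - q i) / 4
      rw [hi]; linarith [hqmono (Nat.lt_succ_self i)]
    · obtain ⟨i, -, hi⟩ := Finset.exists_mem_eq_inf' hGne δb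
      rw [hi]; exact hδb i
  -- continuity: fix `ε`, work at scale `δ = min ε δ₀`
  rw [Metric.continuousAt_iff']
  intro ε hε
  set δ : ℝ := min ε δ₀ with hδ
  have hδpos : 0 < δ := lt_min hε hδ₀pos
  have hδε : δ ≤ ε := min_le_left _ _
  have hδδ₀ : δ ≤ δ₀ := min_le_right ε δ₀
  have hδgap : ∀ i ≤ j, 4 * δ ≤ q (i + 1) - q i := fun i hi ↦ by
    have := hδ₀gap i hi; linarith
  have hδbox : ∀ i ≤ j, δ ≤ δb i := fun i hi ↦ hδδ₀.trans (hδ₀box i hi)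
  -- consequences of the gaps
  have hq1 : 4 * δ ≤ q 1 := by have := hδgap 0 (by omega); rw [hq0] at this; linarith
  have hqle : ∀ {i k : ℕ}, i ≤ k → q i ≤ q k := fun h ↦ hqmono.monotone h
  have hqsep : ∀ {i k : ℕ}, i < k → k ≤ j + 1 → q i + 4 * δ ≤ q k := by
    intro i k hik hk
    induction k with
    | zero => omega
    | succ k ih =>
      rcases Nat.lt_succ_iff_lt_or_eq.1 hik with h | h
      · have := ih h (by omega); have := hδgap k (by omega); linarith [hδpos]
      · subst h; have := hδgap i (by omega); linarith
  set Xm : ℝ := (q j + q (j + 1)) / 2 with hXm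
  have hXm1 : q j + δ < Xm := by have := hδgap j le_rfl; rw [hXm]; linarith
  have hXm2 : Xm < q (j + 1) := by have := hδgap j le_rfl; rw [hXm]; linarith [hδpos]
  -- the compact set `K` away from the boxes, zero-free at time `t`
  set U : Set ℝ := ⋃ m ∈ Finset.Icc 1 j, Ioo (q m - δ) (q m + δ) with hU
  have hUopen : IsOpen U := isOpen_biUnion fun _ _ ↦ isOpen_Ioo
  set K : Set ℝ := Icc 0 Xm ∩ Uᶜ with hK
  have hKc : IsCompact K := isCompact_Icc.inter_right hUopen.isClosed_compl
  have hmemU : ∀ {x : ℝ} {m : ℕ}, 1 ≤ m → m ≤ j → x ∈ Ioo (q m - δ) (q m + δ) → x ∈ U :=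
    fun hm1 hmj hx ↦ mem_biUnion (Finset.mem_Icc.2 ⟨hm1, hmj⟩) hx
  have hKt : ∀ x ∈ K, deBruijnH t x ≠ 0 := by
    rintro x ⟨⟨hx0, hxX⟩, hxU⟩ hx
    have hxpos : 0 < x := lt_of_le_of_ne hx0 fun h ↦ by
      rw [← h] at hx; exact deBruijnH_apply_zero_ne_zero t (by simpa using hx)
    obtain ⟨m, hm1, hmx⟩ := exists_deBruijnZero_eq hΛ hxpos hx
    have hmj : m ≤ j := by
      by_contra hlt
      have : q (j + 1) ≤ q m := hqle (by omega)
      rw [show q m = x from hmx] at this; linarith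
    exact hxU (hmemU hm1 hmj ⟨by rw [show q m = x from hmx]; linarith, by
      rw [show q m = x from hmx]; linarith⟩)
  -- sign changes at time `t` on each box
  have hsign : ∀ l, 1 ≤ l → l ≤ j →
      (deBruijnH t ((q l - δ : ℝ) : ℂ)).re * (deBruijnH t ((q l + δ : ℝ) : ℂ)).re < 0 := by
    intro l hl1 hlj
    have hc : q l ∈ Ioo (q l - δ) (q l + δ) := ⟨by linarith, by linarith⟩
    have hz : deBruijnH t (q l) = 0 := deBruijnH_deBruijnZero hΛ hl1
    have hD : ∀ x ∈ Icc (q l - δ) (q l + δ),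
        0 < (deriv (deBruijnH t) (q l)).re * (deriv (deBruijnH t) x).re := fun x hx ↦
      hbox l hl1 t ⟨by linarith [hδb l], by linarith [hδb l]⟩ x
        ⟨by linarith [hx.1, hδbox l hlj], by linarith [hx.2, hδbox l hlj]⟩
    exact re_mul_re_neg_of_zero hc hz hD
  -- gather the eventual (in `s`) properties
  have hE1 : ∀ᶠ s in 𝓝 t, ∀ x ∈ K, deBruijnH s x ≠ 0 := eventually_forall_ne_zero_of_isCompact hKc hKt
  have hE2 : ∀ᶠ s in 𝓝 t, ∀ l ∈ Finset.Icc 1 j,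
      (deBruijnH s ((q l - δ : ℝ) : ℂ)).re * (deBruijnH s ((q l + δ : ℝ) : ℂ)).re < 0 := by
    rw [Finset.eventually_all]
    intro l hl
    rw [Finset.mem_Icc] at hl
    exact eventually_re_mul_re_neg (hsign l hl.1 hl.2)
  have hE3 : ∀ᶠ s in 𝓝 t, ∀ l ∈ Finset.Icc 1 j, ∀ x ∈ Icc (q l - δ) (q l + δ),
      0 < (deriv (deBruijnH t) (q l)).re * (deriv (deBruijnH s) x).re := by
    rw [Finset.eventually_all]
    intro l hl
    rw [Finset.mem_Icc] at hl
    exact eventually_box (hδb l) (hbox l hl.1) (hδbox l hl.2)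
  filter_upwards [hE1, hE2, hE3, lt_mem_nhds ht₁] with s hs1 hs2 hs3 hs4
  have hΛs : ∃ t₁ : ℝ, t₁ < s ∧ HasOnlyRealZeros (deBruijnH t₁) := ⟨t₁, hs4, hreal⟩
  have hxmono : StrictMono (deBruijnZero s) := strictMono_deBruijnZero hΛs
  -- uniqueness of zeros of `H_s` in each box
  have huniq : ∀ l, 1 ≤ l → l ≤ j → ∀ x y : ℝ, x ∈ Icc (q l - δ) (q l + δ) →
      y ∈ Icc (q l - δ) (q l + δ) → deBruijnH s x = 0 → deBruijnH s y = 0 → x = y := by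
    intro l hl1 hlj x y hx hy hx0 hy0
    refine zero_unique_of_deriv_ne_zero (fun z hz ↦ ?_) hx hy hx0 hy0
    have := hs3 l (Finset.mem_Icc.2 ⟨hl1, hlj⟩) z hz
    intro h0; rw [h0, mul_zero] at this; exact lt_irrefl _ this
  -- the induction on the index
  have key : ∀ i : ℕ, i ≤ j → deBruijnZero s i ∈ Ioo (q i - δ) (q i + δ) := by
    intro i
    induction i with
    | zero => intro _; rw [deBruijnZero_zero, hq0]; exact ⟨by linarith, by linarith⟩
    | succ i ih =>
      intro hij
      have hi : i ≤ j := by omega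
      obtain ⟨hlo, hhi⟩ := ih hi
      -- a zero `z` of `H_s` in the `(i+1)`-st box
      obtain ⟨z, hz, hz0⟩ := exists_zero_of_re_mul_re_neg (by linarith)
        (hs2 (i + 1) (Finset.mem_Icc.2 ⟨by omega, hij⟩))
      have hgap := hδgap i hi
      have hzpos : 0 < z := by
        have : q 1 ≤ q (i + 1) := hqle (by omega)
        linarith [hz.1]
      obtain ⟨k, hk1, hkz⟩ := exists_deBruijnZero_eq hΛs hzpos hz0
      -- `z > x_i(s)`, so `k > i` and `x_{i+1}(s) ≤ z`
      have hzi : deBruijnZero s i < z := by linarith [hz.1]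
      have hki : i < k := by
        rw [← hkz] at hzi; exact hxmono.lt_iff_lt.1 hzi
      have hup : deBruijnZero s (i + 1) ≤ z := by
        rw [← hkz]; exact hxmono.monotone (by omega)
      refine ⟨?_, lt_of_le_of_lt hup hz.2⟩
      -- lower bound: otherwise `x_{i+1}(s)` would be a zero in the zero-free region
      by_contra hlow
      push Not at hlow
      have hxz : deBruijnH s (deBruijnZero s (i + 1)) = 0 := deBruijnH_deBruijnZero hΛs (by omega)
      have hxpos : 0 < deBruijnZero s (i + 1) := deBruijnZero_pos hΛs (by omega)
      have hxgt : deBruijnZero s i < deBruijnZero s (i + 1) := hxmono (Nat.lt_succ_self i)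
      have hxX : deBruijnZero s (i + 1) ≤ Xm := by
        have : q (i + 1) ≤ q j := hqle hij
        linarith
      -- it is not in any box `m ≠ i`, and not in box `i` by uniqueness (or triviality for `i = 0`)
      have hnotU : deBruijnZero s (i + 1) ∉ U := by
        intro hmem
        rw [hU, mem_iUnion₂] at hmem
        obtain ⟨m, hm, hmx⟩ := hmem
        rw [Finset.mem_Icc] at hm
        rcases lt_trichotomy m i with hmi | hmi | hmi
        · -- `m < i`: the box `m` lies below `x_i(s)`
          have := hqsep hmi (by omega)
          linarith [hmx.2]
        · -- `m = i ≥ 1`: two distinct zeros in box `i`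
          rw [hmi] at hm hmx
          have heq := huniq i hm.1 hm.2 (deBruijnZero s i) (deBruijnZero s (i + 1))
            ⟨hlo.le, hhi.le⟩ ⟨hmx.1.le, hmx.2.le⟩ (deBruijnH_deBruijnZero hΛs hm.1) hxz
          linarith
        · -- `m > i`: then `m ≥ i + 1` and the box `m` lies above `q (i+1) - δ`
          have : q (i + 1) ≤ q m := hqle (by omega)
          linarith [hmx.1]
      exact hs1 _ ⟨⟨hxpos.le, hxX⟩, hnotU⟩ hxz
  obtain ⟨h1, h2⟩ := key j le_rfl
  rw [Real.dist_eq, abs_lt]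
  constructor <;> linarith

/-- `t ↦ x_j(t)` is continuous on `(t₁, ∞)` whenever `H_{t₁}` has only real zeros (in particular
on `(Λ, ∞)`). [cite: RodgersTaoFMP2020, Thm. 4.1] -/
theorem continuousOn_deBruijnZero {t₁ : ℝ} (hreal : HasOnlyRealZeros (deBruijnH t₁)) (j : ℕ) :
    ContinuousOn (fun s ↦ deBruijnZero s j) (Ioi t₁) :=
  fun _ ht ↦ (continuousAt_deBruijnZero ⟨t₁, ht, hreal⟩ j).continuousWithinAt

/-- Continuity of `t ↦ Ẽ_{jk}(t)` at every `t > Λ`, for `j ≠ k`. [cite: RodgersTaoFMP2020, §7] -/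
theorem continuousAt_renormEnergy {t : ℝ} (hΛ : ∃ t₁ : ℝ, t₁ < t ∧ HasOnlyRealZeros (deBruijnH t₁))
    {j k : ℕ} (hjk : j ≠ k) : ContinuousAt (fun s ↦ renormEnergy s j k) t := by
  simp only [renormEnergy_eq]
  have hξ : classicalLocation (k : ℝ) - classicalLocation (j : ℝ) ≠ 0 :=
    sub_ne_zero.2 fun h ↦ hjk (classicalLocation_natCast_injective h).symm
  have harg : ContinuousAt (fun s ↦ (deBruijnZero s k - deBruijnZero s j) /
      (classicalLocation (k : ℝ) - classicalLocation (j : ℝ))) t :=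
    ((continuousAt_deBruijnZero hΛ k).sub (continuousAt_deBruijnZero hΛ j)).div_const _
  have hne : (deBruijnZero t k - deBruijnZero t j) /
      (classicalLocation (k : ℝ) - classicalLocation (j : ℝ)) ≠ 0 :=
    div_ne_zero (sub_ne_zero.2 fun h ↦ hjk ((strictMono_deBruijnZero hΛ).injective h).symm) hξ
  have hcomp : ContinuousAt (fun s ↦ renormPotential ((deBruijnZero s k - deBruijnZero s j) /
      (classicalLocation (k : ℝ) - classicalLocation (j : ℝ)))) t :=
    (continuousAt_renormPotential hne).comp_of_eq harg rfl
  exact hcomp.div_const _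

/-- Continuity of the window energy `t ↦ Ẽ^I(t)` at every `t > Λ`. [cite: RodgersTaoFMP2020, §7] -/
theorem continuousAt_renormEnergyOn {t : ℝ} (hΛ : ∃ t₁ : ℝ, t₁ < t ∧ HasOnlyRealZeros (deBruijnH t₁))
    (I : Finset ℕ) : ContinuousAt (fun s ↦ renormEnergyOn s I) t := by
  simp only [renormEnergyOn_eq]
  exact tendsto_finsetSum _ fun p hp ↦ continuousAt_renormEnergy hΛ (Finset.mem_offDiag.1 hp).2.2

/-- Continuity of the renormalised energies in `t` on `(t₁, ∞)` whenever `H_{t₁}` has only real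
zeros. [cite: RodgersTaoFMP2020, §7] -/
theorem continuousOn_renormEnergyOn_Ioi {t₁ : ℝ} (hreal : HasOnlyRealZeros (deBruijnH t₁))
    (I : Finset ℕ) : ContinuousOn (fun s ↦ renormEnergyOn s I) (Ioi t₁) :=
  fun _ ht ↦ (continuousAt_renormEnergyOn ⟨t₁, ht, hreal⟩ I).continuousWithinAt

/-- Measurability in `t` of the window energies on `(t₁, ∞)` (restricted): the function
`s ↦ Ẽ^I(s)` is a.e.-strongly measurable for `volume.restrict (Ioc a b)` when `t₁ ≤ a`.
[folklore] -/
theorem aestronglyMeasurable_renormEnergyOn {t₁ a b : ℝ} (hreal : HasOnlyRealZeros (deBruijnH t₁))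
    (ha : t₁ < a) (I : Finset ℕ) :
    AEStronglyMeasurable (fun s ↦ renormEnergyOn s I) (volume.restrict (Ioc a b)) :=
  ((continuousOn_renormEnergyOn_Ioi hreal I).mono fun _ hs ↦ lt_trans ha hs.1).aestronglyMeasurable
    measurableSet_Ioc

/-- **Integrability of sub-window energies.** Under `Λ < 0` with witness `t₀`, if the energy of a
window `J` is interval-integrable on `[t₀/4, 0]` then so is the energy of every sub-window `I ⊆ J`
(`0 ≤ Ẽ^I ≤ Ẽ^J` and continuity in `t`). [cite: RodgersTaoFMP2020, §7] -/
theorem intervalIntegrable_renormEnergyOn_mono {t₀ : ℝ} (ht₀ : t₀ < 0)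
    (hreal : HasOnlyRealZeros (deBruijnH t₀)) {I J : Finset ℕ} (hIJ : I ⊆ J)
    (hJ : IntervalIntegrable (fun t ↦ renormEnergyOn t J) volume (t₀ / 4) 0) :
    IntervalIntegrable (fun t ↦ renormEnergyOn t I) volume (t₀ / 4) 0 := by
  have hle : t₀ / 4 ≤ 0 := by linarith
  rw [intervalIntegrable_iff_integrableOn_Ioc_of_le hle] at hJ ⊢
  refine hJ.mono' (aestronglyMeasurable_renormEnergyOn hreal (by linarith) I)
    (ae_restrict_of_forall_mem measurableSet_Ioc fun t ht ↦ ?_)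
  have hΛ : ∃ t₁ : ℝ, t₁ < t ∧ HasOnlyRealZeros (deBruijnH t₁) := ⟨t₀, by linarith [ht.1], hreal⟩
  rw [Real.norm_of_nonneg (renormEnergyOn_nonneg_of_lt hΛ I)]
  exact renormEnergyOn_mono_of_lt hΛ hIJ



/-! ## The regularity inputs of §8 (arXiv v5), discharged -/

/-- **The ordering hypothesis of `RodgersTaoEnergyV5Proofs.lean`, discharged**: under `Λ < 0`
(witness `t₀`), for every `t ∈ (t₀, 0]` the positive-index zeros `j ↦ x_{j+1}(t)` are strictly
increasing (§1.2 of the source; `strictMono_deBruijnZero`). [cite: RodgersTaoFMP2020, §1.2] -/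
theorem rodgers_tao_zeros_ordered (t₀ : ℝ) (_ht₀ : t₀ < 0) (hreal : HasOnlyRealZeros (deBruijnH t₀)) :
    ∀ t ∈ Ioc t₀ 0, StrictMono fun j : ℕ ↦ deBruijnZero t (j + 1) :=
  fun _ ht _ _ hjk ↦ strictMono_deBruijnZero ⟨t₀, ht.1, hreal⟩ (Nat.succ_lt_succ hjk)

/-- **The continuity hypothesis of `RodgersTaoEnergyV5Proofs.lean`, discharged**: under `Λ < 0`
(witness `t₀`), each `t ↦ x_{j+1}(t)` is continuous on `(t₀, 0]` (Thm. 4.1 of the source;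
`continuousOn_deBruijnZero`). [cite: RodgersTaoFMP2020, Thm. 4.1] -/
theorem rodgers_tao_zeros_continuousOn (t₀ : ℝ) (_ht₀ : t₀ < 0)
    (hreal : HasOnlyRealZeros (deBruijnH t₀)) :
    ∀ j : ℕ, ContinuousOn (fun t : ℝ ↦ deBruijnZero t (j + 1)) (Ioc t₀ 0) :=
  fun j ↦ (continuousOn_deBruijnZero hreal (j + 1)).mono fun _ ht ↦ ht.1

end Literature.NumberTheory.LFunctions

end
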